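import Summits.AtomisticToContinuum.Crystallization.Theorems.FrustratedLawDichotomyStrainedPatchHomTermEvalW
import Summits.AtomisticToContinuum.Crystallization.Theorems.FrustratedLawDichotomyStrainedPatchHomGram

/-!
# The (P4) fcc GRAM-LEAF BRIDGE, v2 (window-safe term checks `curvOK2`/`valLoOK2`/`derivOK2`): statement and proof verbatim from `…HomLeafBridge` (def-free)

decomp-a2c hand-2 g21 (crux `AperiodicFrustratedLawGap`, stmt-AtomisticToContinuum-27623; critic row 783 (4)(iii) «the SOUNDNESS BRIDGE … against the
REAL-valued tree defs is the actual L-size work: TYPE IT … so hands can start it NOW»).  This is the bridge AT LEAF LEVEL, for the fcc/Bravais slice in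
hand-1's Gram coordinates (`…HomGram.boxSum_ge_of_gramLeaf`, W := the record potential `W₄₅ = effPot w₄₅ ω₄ (3/400)`):

Data of a leaf (all INTEGERS at scale `SC = 2^48`): centre `c0 : Fin 9 → ℤ`, half-widths `w : Fin 9 → ℤ`, target `μ : ℤ`, and per lattice label
`b ∈ [−7,7]³ ∖ 0` the term hints `M b, V b, Dlo b, Dhi b : ℤ` (in the reflected checker these are COMPUTED from `c0, w`, not stored).  With the
exact integer centre and radius of the term's squared-length range, `q0 b = Σₖ bᵢbⱼ·c0ₖ`, `r b = Σₖ |bᵢbⱼ|·wₖ`: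

  ★★★ `boxSum_ge_of_termChecks2` :  (∀ b, `curvOK (q0 b − r b) (q0 b + r b) (M b)`) ∧ (∀ b, `valLoOK (q0 b) (V b)`) ∧ (∀ b, `derivOK (q0 b) (Dlo b) (Dhi b)`)
      ∧ `μ/SC ≤ Σ_b V b/SC − Σₖ max |Σ_b min(Dlo b·L_bk, Dhi b·L_bk)| |Σ_b max(Dlo b·L_bk, Dhi b·L_bk)|/SC · wₖ/SC − ½ Σ_b (M b/SC)·(r b/SC)²`
      (SIGNED gradient enclosure: the sum over `b` is accumulated as an interval BEFORE the absolute value — near equilibrium the net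
      gradient is small although `Σ_b |φ′_b·L_bk|` is not; v1's `…HomLeafBridge` used the latter)
      ⟹ for EVERY deformation `G` whose frame Gram data lie in the box `|⟪G fᵢ, G fⱼ⟫ − c0ₖ/SC| ≤ wₖ/SC`:  `μ/SC ≤ Σ_b W₄₅ ‖latPt G fccVec b‖`.

Every analytic fact is discharged here once and for all (`hd` by `…TermCalculus.hasDerivAt_phi45`, `hM`/`hmono` by `…TermEval.curvOK_sound`, the centre
values/derivatives by `…TermEvalPoint.valLoOK_sound` / `derivOK_sound`, the gradient term by `|x·L| ≤ max |lo·L| |hi·L|` on an enclosure); what remains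
for the reflected `check` above this theorem is INTEGER/LIST PLUMBING ONLY (evaluate the three Bool checks over the 3374 labels and the one inequality with
outward rounding).  No definitions; 0 sorry; standard axioms.  `--supports stmt-AtomisticToContinuum-27623`.
-/

noncomputable section

namespace Summit.AtomisticToContinuum.Crystallization.Theorems.FrustratedLawDichotomyStrainedPatchHomLeafBridgeW

open scoped BigOperators RealInnerProductSpace
open Set
open Literature.Analysis.ValidatedNumerics.Numerics
open Summit.AtomisticToContinuum.Crystallization.Theorems.ChargedEnergyGapNegative (E3)
open Summit.AtomisticToContinuum.Crystallization.Theorems.FrustratedLawDichotomySchurCut (effPot w₄₅ ω₄)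
open Summit.AtomisticToContinuum.Crystallization.Theorems.FrustratedLawDichotomyStrainedPatchHomSplit (latPt)
open Summit.AtomisticToContinuum.Crystallization.Theorems.FrustratedLawDichotomyStrainedPatchHomTermCalculus (hasDerivAt_phi45)
open Summit.AtomisticToContinuum.Crystallization.Theorems.FrustratedLawDichotomyStrainedPatchHomTermEvalW
  (curvOK2 curvOK2_sound valLoOK2 derivOK2 valLoOK2_sound derivOK2_sound)
open Summit.AtomisticToContinuum.Crystallization.Theorems.FrustratedLawDichotomyStrainedPatchHomGram (boxSum_ge_of_gramLeaf)
open Literature.Barriers.AtomisticToContinuum.FlatleyTheil2015 (fccVec)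

/-! ## §1. Small real-analysis helpers -/

/-- `curvOK2` enforces a positive lower end of the range. [folklore] -/
theorem curvOK2_pos {qlo qhi M : ℤ} (h : curvOK2 qlo qhi M = true) : 0 < qlo := by
  unfold curvOK2 at h
  simp only [Bool.and_eq_true, decide_eq_true_eq] at h
  exact h.1.1.2

/-- On an enclosure `x ∈ [lo, hi]`: `min (lo·L) (hi·L) ≤ x·L`. [folklore] -/
theorem min_mul_le_of_mem {x lo hi L : ℝ} (h1 : lo ≤ x) (h2 : x ≤ hi) : min (lo * L) (hi * L) ≤ x * L := by
  rcases le_or_gt 0 L with hL | hL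
  · exact (min_le_left _ _).trans (mul_le_mul_of_nonneg_right h1 hL)
  · exact (min_le_right _ _).trans (mul_le_mul_of_nonpos_right h2 hL.le)

/-- On an enclosure `x ∈ [lo, hi]`: `x·L ≤ max (lo·L) (hi·L)`. [folklore] -/
theorem mul_le_max_of_mem {x lo hi L : ℝ} (h1 : lo ≤ x) (h2 : x ≤ hi) : x * L ≤ max (lo * L) (hi * L) := by
  rcases le_or_gt 0 L with hL | hL
  · exact (mul_le_mul_of_nonneg_right h2 hL).trans (le_max_right _ _)
  · exact (mul_le_mul_of_nonpos_right h1 hL.le).trans (le_max_left _ _)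

/-! ## §2. The bridge -/

/-- ★★★ **THE (P4) fcc GRAM-LEAF BRIDGE.**  See the module docstring.  Index `k : Fin 9` is read as `(i, j) = finProdFinEquiv.symm k`; the term functional is
`L_b k = bᵢ·bⱼ`; `box7 = [−7,7]³ ∖ 0`. [folklore] -/
theorem boxSum_ge_of_termChecks2 (c0 w : Fin 9 → ℤ) (M V Dlo Dhi : (Fin 3 → ℤ) → ℤ) (μ : ℤ) (hw : ∀ k, 0 ≤ w k)
    (hcurv : ∀ b ∈ (Fintype.piFinset fun _ : Fin 3 => Finset.Icc (-7 : ℤ) 7).filter (fun b => b ≠ 0),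
      curvOK2 (∑ k, b ((@finProdFinEquiv 3 3).symm k).1 * b ((@finProdFinEquiv 3 3).symm k).2 * c0 k -
          ∑ k, |b ((@finProdFinEquiv 3 3).symm k).1 * b ((@finProdFinEquiv 3 3).symm k).2| * w k)
        (∑ k, b ((@finProdFinEquiv 3 3).symm k).1 * b ((@finProdFinEquiv 3 3).symm k).2 * c0 k +
          ∑ k, |b ((@finProdFinEquiv 3 3).symm k).1 * b ((@finProdFinEquiv 3 3).symm k).2| * w k) (M b) = true)
    (hval : ∀ b ∈ (Fintype.piFinset fun _ : Fin 3 => Finset.Icc (-7 : ℤ) 7).filter (fun b => b ≠ 0),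
      valLoOK2 (∑ k, b ((@finProdFinEquiv 3 3).symm k).1 * b ((@finProdFinEquiv 3 3).symm k).2 * c0 k) (V b) = true)
    (hder : ∀ b ∈ (Fintype.piFinset fun _ : Fin 3 => Finset.Icc (-7 : ℤ) 7).filter (fun b => b ≠ 0),
      derivOK2 (∑ k, b ((@finProdFinEquiv 3 3).symm k).1 * b ((@finProdFinEquiv 3 3).symm k).2 * c0 k) (Dlo b) (Dhi b) = true)
    (hineq : (μ : ℝ) / SC ≤
      ∑ b ∈ (Fintype.piFinset fun _ : Fin 3 => Finset.Icc (-7 : ℤ) 7).filter (fun b => b ≠ 0), (V b : ℝ) / SC -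
        ∑ k, max (|∑ b ∈ (Fintype.piFinset fun _ : Fin 3 => Finset.Icc (-7 : ℤ) 7).filter (fun b => b ≠ 0),
            min (((Dlo b : ℝ) / SC) * (((b ((@finProdFinEquiv 3 3).symm k).1 : ℤ) : ℝ) * ((b ((@finProdFinEquiv 3 3).symm k).2 : ℤ) : ℝ))) (((Dhi b : ℝ) / SC) * (((b ((@finProdFinEquiv 3 3).symm k).1 : ℤ) : ℝ) * ((b ((@finProdFinEquiv 3 3).symm k).2 : ℤ) : ℝ)))|)
          (|∑ b ∈ (Fintype.piFinset fun _ : Fin 3 => Finset.Icc (-7 : ℤ) 7).filter (fun b => b ≠ 0),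
            max (((Dlo b : ℝ) / SC) * (((b ((@finProdFinEquiv 3 3).symm k).1 : ℤ) : ℝ) * ((b ((@finProdFinEquiv 3 3).symm k).2 : ℤ) : ℝ))) (((Dhi b : ℝ) / SC) * (((b ((@finProdFinEquiv 3 3).symm k).1 : ℤ) : ℝ) * ((b ((@finProdFinEquiv 3 3).symm k).2 : ℤ) : ℝ)))|) *
          ((w k : ℝ) / SC) -
        1 / 2 * ∑ b ∈ (Fintype.piFinset fun _ : Fin 3 => Finset.Icc (-7 : ℤ) 7).filter (fun b => b ≠ 0),
          ((M b : ℝ) / SC) * (∑ k, |((b ((@finProdFinEquiv 3 3).symm k).1 : ℤ) : ℝ) * ((b ((@finProdFinEquiv 3 3).symm k).2 : ℤ) : ℝ)| *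
            ((w k : ℝ) / SC)) ^ 2)
    (G : E3 →L[ℝ] E3)
    (hbox : ∀ k : Fin 9, |⟪G (fccVec ((@finProdFinEquiv 3 3).symm k).1), G (fccVec ((@finProdFinEquiv 3 3).symm k).2)⟫ - (c0 k : ℝ) / SC| ≤
      (w k : ℝ) / SC) :
    (μ : ℝ) / SC ≤ ∑ b ∈ (Fintype.piFinset fun _ : Fin 3 => Finset.Icc (-7 : ℤ) 7).filter (fun b => b ≠ 0), effPot w₄₅ ω₄ (3 / 400) ‖latPt G fccVec b‖ := by
  have hS := SC_pos
  -- integer centre / radius of a term's range, read in ℝ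
  have hq0 : ∀ b : Fin 3 → ℤ, ∑ k, ((b ((@finProdFinEquiv 3 3).symm k).1 : ℝ) * (b ((@finProdFinEquiv 3 3).symm k).2 : ℝ)) * ((c0 k : ℝ) / SC) =
      ((∑ k, b ((@finProdFinEquiv 3 3).symm k).1 * b ((@finProdFinEquiv 3 3).symm k).2 * c0 k : ℤ) : ℝ) / SC := by
    intro b; push_cast; rw [Finset.sum_div]; exact Finset.sum_congr rfl fun k _ => by ring
  have hr : ∀ b : Fin 3 → ℤ, ∑ k, |((b ((@finProdFinEquiv 3 3).symm k).1 : ℝ) * (b ((@finProdFinEquiv 3 3).symm k).2 : ℝ))| * ((w k : ℝ) / SC) =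
      ((∑ k, |b ((@finProdFinEquiv 3 3).symm k).1 * b ((@finProdFinEquiv 3 3).symm k).2| * w k : ℤ) : ℝ) / SC := by
    intro b; push_cast; rw [Finset.sum_div]; exact Finset.sum_congr rfl fun k _ => by ring
  refine boxSum_ge_of_gramLeaf (effPot w₄₅ ω₄ (3 / 400)) (fun t => deriv (effPot w₄₅ ω₄ (3 / 400)) (Real.sqrt t) / (2 * Real.sqrt t))
    _ fccVec (fun b => (M b : ℝ) / SC) (fun k => (c0 k : ℝ) / SC) (fun k => (w k : ℝ) / SC) ((μ : ℝ) / SC)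
    (fun k => div_nonneg (by exact_mod_cast hw k) hS.le) (fun b hb => (curvOK2_sound (hcurv b hb)).1) (fun b hb t ht => ?_)
    (fun b hb => ?_) ?_ G hbox
  · -- hd: differentiability on the range (positive lower end from `curvOK`)
    have hpos := curvOK2_pos (hcurv b hb)
    rw [hq0, hr, ← sub_div] at ht
    have : (0:ℝ) < t := by
      have h0 : (0:ℝ) < ((∑ k, b ((@finProdFinEquiv 3 3).symm k).1 * b ((@finProdFinEquiv 3 3).symm k).2 * c0 k -
          ∑ k, |b ((@finProdFinEquiv 3 3).symm k).1 * b ((@finProdFinEquiv 3 3).symm k).2| * w k : ℤ) : ℝ) / SC :=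
        div_pos (by exact_mod_cast hpos) hS
      push_cast at h0 ht
      exact h0.trans_le ht.1
    exact hasDerivAt_phi45 this
  · -- hmono from `curvOK_sound`
    have h := (curvOK2_sound (hcurv b hb)).2
    rw [hq0, hr, ← sub_div, ← add_div]
    push_cast at h ⊢
    exact h
  · -- hcheck from the value / derivative enclosures and the integer-data inequality
    have hV : ∀ b ∈ (Fintype.piFinset fun _ : Fin 3 => Finset.Icc (-7 : ℤ) 7).filter (fun b => b ≠ 0),
        (V b : ℝ) / SC ≤ effPot w₄₅ ω₄ (3 / 400) (Real.sqrt (∑ k, ((b ((@finProdFinEquiv 3 3).symm k).1 : ℝ) *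
          (b ((@finProdFinEquiv 3 3).symm k).2 : ℝ)) * ((c0 k : ℝ) / SC))) := by
      intro b hb; rw [hq0]; exact valLoOK2_sound (hval b hb)
    have hD : ∀ b ∈ (Fintype.piFinset fun _ : Fin 3 => Finset.Icc (-7 : ℤ) 7).filter (fun b => b ≠ 0), ∀ k : Fin 9,
        min (((Dlo b : ℝ) / SC) * (((b ((@finProdFinEquiv 3 3).symm k).1 : ℤ) : ℝ) * ((b ((@finProdFinEquiv 3 3).symm k).2 : ℤ) : ℝ))) (((Dhi b : ℝ) / SC) * (((b ((@finProdFinEquiv 3 3).symm k).1 : ℤ) : ℝ) * ((b ((@finProdFinEquiv 3 3).symm k).2 : ℤ) : ℝ))) ≤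
          deriv (effPot w₄₅ ω₄ (3 / 400)) (Real.sqrt (∑ j, ((b ((@finProdFinEquiv 3 3).symm j).1 : ℝ) *
            (b ((@finProdFinEquiv 3 3).symm j).2 : ℝ)) * ((c0 j : ℝ) / SC))) /
            (2 * Real.sqrt (∑ j, ((b ((@finProdFinEquiv 3 3).symm j).1 : ℝ) * (b ((@finProdFinEquiv 3 3).symm j).2 : ℝ)) * ((c0 j : ℝ) / SC))) *
          (((b ((@finProdFinEquiv 3 3).symm k).1 : ℤ) : ℝ) * ((b ((@finProdFinEquiv 3 3).symm k).2 : ℤ) : ℝ)) ∧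
        deriv (effPot w₄₅ ω₄ (3 / 400)) (Real.sqrt (∑ j, ((b ((@finProdFinEquiv 3 3).symm j).1 : ℝ) *
            (b ((@finProdFinEquiv 3 3).symm j).2 : ℝ)) * ((c0 j : ℝ) / SC))) /
            (2 * Real.sqrt (∑ j, ((b ((@finProdFinEquiv 3 3).symm j).1 : ℝ) * (b ((@finProdFinEquiv 3 3).symm j).2 : ℝ)) * ((c0 j : ℝ) / SC))) *
          (((b ((@finProdFinEquiv 3 3).symm k).1 : ℤ) : ℝ) * ((b ((@finProdFinEquiv 3 3).symm k).2 : ℤ) : ℝ)) ≤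
          max (((Dlo b : ℝ) / SC) * (((b ((@finProdFinEquiv 3 3).symm k).1 : ℤ) : ℝ) * ((b ((@finProdFinEquiv 3 3).symm k).2 : ℤ) : ℝ))) (((Dhi b : ℝ) / SC) * (((b ((@finProdFinEquiv 3 3).symm k).1 : ℤ) : ℝ) * ((b ((@finProdFinEquiv 3 3).symm k).2 : ℤ) : ℝ))) := by
      intro b hb k
      have hm := derivOK2_sound (hder b hb)
      rw [← hq0] at hm
      exact ⟨min_mul_le_of_mem hm.1 hm.2, mul_le_max_of_mem hm.1 hm.2⟩
    -- the three pieces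
    have h1 : ∑ b ∈ (Fintype.piFinset fun _ : Fin 3 => Finset.Icc (-7 : ℤ) 7).filter (fun b => b ≠ 0), (V b : ℝ) / SC ≤
        ∑ b ∈ (Fintype.piFinset fun _ : Fin 3 => Finset.Icc (-7 : ℤ) 7).filter (fun b => b ≠ 0),
          effPot w₄₅ ω₄ (3 / 400) (Real.sqrt (∑ k, ((b ((@finProdFinEquiv 3 3).symm k).1 : ℝ) *
            (b ((@finProdFinEquiv 3 3).symm k).2 : ℝ)) * ((c0 k : ℝ) / SC))) := Finset.sum_le_sum hV
    have h2 : ∀ k : Fin 9,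
        |∑ b ∈ (Fintype.piFinset fun _ : Fin 3 => Finset.Icc (-7 : ℤ) 7).filter (fun b => b ≠ 0),
          deriv (effPot w₄₅ ω₄ (3 / 400)) (Real.sqrt (∑ j, ((b ((@finProdFinEquiv 3 3).symm j).1 : ℝ) *
            (b ((@finProdFinEquiv 3 3).symm j).2 : ℝ)) * ((c0 j : ℝ) / SC))) /
            (2 * Real.sqrt (∑ j, ((b ((@finProdFinEquiv 3 3).symm j).1 : ℝ) * (b ((@finProdFinEquiv 3 3).symm j).2 : ℝ)) * ((c0 j : ℝ) / SC))) *
          (((b ((@finProdFinEquiv 3 3).symm k).1 : ℤ) : ℝ) * ((b ((@finProdFinEquiv 3 3).symm k).2 : ℤ) : ℝ))| *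
          ((w k : ℝ) / SC) ≤
        max (|∑ b ∈ (Fintype.piFinset fun _ : Fin 3 => Finset.Icc (-7 : ℤ) 7).filter (fun b => b ≠ 0),
            min (((Dlo b : ℝ) / SC) * (((b ((@finProdFinEquiv 3 3).symm k).1 : ℤ) : ℝ) * ((b ((@finProdFinEquiv 3 3).symm k).2 : ℤ) : ℝ))) (((Dhi b : ℝ) / SC) * (((b ((@finProdFinEquiv 3 3).symm k).1 : ℤ) : ℝ) * ((b ((@finProdFinEquiv 3 3).symm k).2 : ℤ) : ℝ)))|)
          (|∑ b ∈ (Fintype.piFinset fun _ : Fin 3 => Finset.Icc (-7 : ℤ) 7).filter (fun b => b ≠ 0),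
            max (((Dlo b : ℝ) / SC) * (((b ((@finProdFinEquiv 3 3).symm k).1 : ℤ) : ℝ) * ((b ((@finProdFinEquiv 3 3).symm k).2 : ℤ) : ℝ))) (((Dhi b : ℝ) / SC) * (((b ((@finProdFinEquiv 3 3).symm k).1 : ℤ) : ℝ) * ((b ((@finProdFinEquiv 3 3).symm k).2 : ℤ) : ℝ)))|) *
          ((w k : ℝ) / SC) := by
      intro k
      refine mul_le_mul_of_nonneg_right ?_ (div_nonneg (by exact_mod_cast hw k) hS.le)
      exact abs_le_max_abs_abs (Finset.sum_le_sum fun b hb => (hD b hb k).1) (Finset.sum_le_sum fun b hb => (hD b hb k).2)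
    have h2' := Finset.sum_le_sum fun k (_ : k ∈ (Finset.univ : Finset (Fin 9))) => h2 k
    linarith [h1, h2', hineq]

end Summit.AtomisticToContinuum.Crystallization.Theorems.FrustratedLawDichotomyStrainedPatchHomLeafBridgeW

end
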